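import Mathlib
import Literature.Computability.AlgebraicComplexity.GroupTheoreticMatMul
import Literature.Computability.AlgebraicComplexity.LineSTPPConeFourier
import Literature.Computability.AlgebraicComplexity.LineSTPPPatterns
import HarnessLib

/-!
# Cone Fourier identities for ARBITRARY STPP families in `F^m`

Topic `Literature/Computability/AlgebraicComplexity`.  For a family of triples of finite sets
`(A_i, B_i, C_i)_{i<N}` in `H = F^m` (`F` a finite field, `q = |F|`) with the simultaneous triple
product property `IsSTPP A B C` (Cohn–Kleinberg–Szegedy–Umans 2005, Def. 5.1, tree form), and a
primitive additive character `ψ` of `F`, put (block character sums over the "difference data"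
`PX = Σ_i A_i × B_i`, `PY = Σ_j B_j × C_j`, `PZ = Σ_k C_k × A_k`)

  `F_X(ξ) = Σ_i Σ_{s'∈A_i, t∈B_i} ψ(ξ⬝(s'−t))`, `F_Y(ξ) = Σ_j Σ_{t'∈B_j, u∈C_j} ψ(ξ⬝(t'−u))`,
  `F_Z(ξ) = Σ_k Σ_{u'∈C_k, s∈A_k} ψ(ξ⬝(u'−s))`  (`blockSum`).

Orthogonality on `F^m` (`LineSTPP.sum_dotProduct_eq`) and the STPP give
* `Σ_ξ F_X F_Y F_Z = q^m · T` with `T ≤ Σ_i |A_i||B_i||C_i|` — the solutions of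
  `(s'−t)+(t'−u)+(u'−s) = 0` are diagonal (`IsSTPP.sum_blockSum_mul_mul_le`);
* `Σ_ξ ‖F_X‖² ≤ q^m · Σ_i |A_i||B_i|` (pattern `(i,i',i')`: `s'−t` determines `(i,s',t)`)
  (`IsSTPP.sum_normSq_blockSum_le`), and `F_X(0) = Σ_i |A_i||B_i|` (`blockSum_zero`);
* the difference map `(k,u',s) ↦ u'−s` is injective on `PZ` (`IsSTPP.injOn_sub`), whence packing
  `Σ_k |C_k||A_k| ≤ q^m` (Blasiak et al. 2017, Lemma 2.4, re-proved in this form) and hyperplane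
  packing `q · Σ_{k ∈ K} |C_k||A_k| ≤ q^m` for any set `K` of blocks with `C_k − A_k ⊆ ξ^⊥`, `ξ ≠ 0`;
* the assembled **cone inequality** (`IsSTPP.cone_inequality`): if `‖F_Z(ξ)‖ ≤ M` for all `ξ ≠ 0` then
  `P_AB · P_BC · P_CA − q^m Σ_i|A_i||B_i||C_i| ≤ M · q^m · √(P_AB P_BC)`, `P_AB = Σ_i|A_i||B_i|` etc.

These generalise the line-specific identities of `LineSTPPConeFourier.lean`/`LineSTPPPatterns.lean`
(which parametrise punctured lines by units); the line and frame cone bounds are the cases where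
`‖F_Z‖` off zero is controlled by hyperplane packing.

## References
* H. Cohn, R. Kleinberg, B. Szegedy, C. Umans, FOCS 2005, arXiv:math/0511460, Def. 5.1.
  [CohnKleinbergSzegedyUmans2005]
* J. Blasiak, T. Church, H. Cohn, J. A. Grochow, E. Naslund, W. F. Sawin, C. Umans, Discrete Analysis
  2017:3, Lemma 2.4. [BlasiakChurchCohnGrochowNaslundSawinUmans2017]
-/

open Finset Matrix

namespace Literature.Computability.AlgebraicComplexity

section ConeIdentities

variable {F : Type*} [Field F] [Fintype F] [DecidableEq F] {m N : ℕ}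

omit [Fintype F] [DecidableEq F] in
/-- `(Σ f)(Σ g) = Σ_{s × t} f g` (bookkeeping). [folklore] -/
theorem sum_mul_sum_eq_sum_product {α β : Type*} (s : Finset α) (t : Finset β) (f : α → ℂ)
    (g : β → ℂ) : (∑ x ∈ s, f x) * (∑ y ∈ t, g y) = ∑ w ∈ s ×ˢ t, f w.1 * g w.2 := by
  rw [Finset.sum_product, Finset.sum_mul_sum]

omit [Fintype F] [DecidableEq F] in
/-- `(Σ f)(Σ g)(Σ h) = Σ_{(s × t) × u} f g h` (bookkeeping). [folklore] -/
theorem sum_mul_sum_mul_sum_eq_sum_product {α β γ : Type*} (s : Finset α) (t : Finset β)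
    (u : Finset γ) (f : α → ℂ) (g : β → ℂ) (h : γ → ℂ) :
    (∑ x ∈ s, f x) * (∑ y ∈ t, g y) * (∑ z ∈ u, h z) =
      ∑ w ∈ (s ×ˢ t) ×ˢ u, f w.1.1 * g w.1.2 * h w.2 := by
  rw [Finset.sum_product, Finset.sum_product, Finset.sum_mul_sum, Finset.sum_mul]
  refine Finset.sum_congr rfl fun x _ => ?_
  rw [Finset.sum_mul]
  refine Finset.sum_congr rfl fun y _ => ?_
  rw [Finset.mul_sum]

/-- The difference data of a pair of set families: `Σ_i A_i × B_i` as a finset of `Σ i, (H × H)`.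
[folklore] -/
def pairData (A B : Fin N → Finset (Fin m → F)) : Finset (Σ _ : Fin N, (Fin m → F) × (Fin m → F)) :=
  univ.sigma fun i => A i ×ˢ B i

omit [Field F] [Fintype F] [DecidableEq F] in
/-- `#(Σ_i A_i × B_i) = Σ_i |A_i||B_i|`. [folklore] -/
theorem card_pairData (A B : Fin N → Finset (Fin m → F)) :
    (pairData A B).card = ∑ i, (A i).card * (B i).card := by
  simp [pairData, Finset.card_sigma, Finset.card_product]

/-- The block character sum `F_{AB}(ξ) = Σ_i Σ_{s∈A_i} Σ_{t∈B_i} ψ(ξ ⬝ (s − t))`. [folklore] -/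
noncomputable def blockSum (ψ : AddChar F ℂ) (A B : Fin N → Finset (Fin m → F)) (ξ : Fin m → F) : ℂ :=
  ∑ x ∈ pairData A B, ψ (ξ ⬝ᵥ (x.2.1 - x.2.2))

omit [Fintype F] [DecidableEq F] in
/-- `F_{AB}(0) = Σ_i |A_i||B_i|`. [folklore] -/
theorem blockSum_zero (ψ : AddChar F ℂ) (A B : Fin N → Finset (Fin m → F)) :
    blockSum ψ A B 0 = ((∑ i, (A i).card * (B i).card : ℕ) : ℂ) := by
  simp [blockSum, card_pairData]

variable {A B C : Fin N → Finset (Fin m → F)}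

omit [Fintype F] [DecidableEq F] in
/-- STPP, pattern `(k', k', k)`: `u' − s = u'' − s''` with `u' ∈ C_k, s ∈ A_k, u'' ∈ C_{k'}, s'' ∈ A_{k'}`
forces `k = k'`, `u' = u''`, `s = s''` — provided every `B_k` is non-empty. [folklore] -/
theorem IsSTPP.sub_inj (hS : IsSTPP A B C) (hB : ∀ i, (B i).Nonempty) {k k' : Fin N}
    {u' s u'' s'' : Fin m → F} (hu' : u' ∈ C k) (hs : s ∈ A k) (hu'' : u'' ∈ C k')
    (hs'' : s'' ∈ A k') (H : u' - s = u'' - s'') : k = k' ∧ u' = u'' ∧ s = s'' := by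
  obtain ⟨t, ht⟩ := hB k'
  obtain ⟨-, hkk, hss, -, huu⟩ := hS k' k' k s hs s'' hs'' t ht t ht u'' hu'' u' hu'
    (by rw [sub_self, add_zero, ← sub_eq_zero.2 H]; abel)
  exact ⟨hkk.symm, huu.symm, hss⟩

omit [Fintype F] [DecidableEq F] in
/-- The difference map `(k, u', s) ↦ u' − s` is injective on `Σ_k C_k × A_k`. [folklore] -/
theorem IsSTPP.injOn_sub (hS : IsSTPP A B C) (hB : ∀ i, (B i).Nonempty) :
    Set.InjOn (fun x : Σ _ : Fin N, (Fin m → F) × (Fin m → F) => x.2.1 - x.2.2)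
      (pairData C A : Set _) := by
  rintro ⟨k, u', s⟩ hx ⟨k', u'', s''⟩ hy H
  simp only [pairData, Finset.coe_sigma, Finset.coe_product, Set.mem_sigma_iff, Finset.coe_univ,
    Set.mem_univ, Set.mem_prod, Finset.mem_coe, true_and] at hx hy
  obtain ⟨rfl, rfl, rfl⟩ := hS.sub_inj hB hx.1 hx.2 hy.1 hy.2 H
  rfl

omit [DecidableEq F] in
/-- Packing (Blasiak et al. 2017, Lemma 2.4, for the pair `(C, A)`): `Σ_k |C_k||A_k| ≤ q^m`.
[folklore] -/
theorem IsSTPP.sum_card_mul_card_le (hS : IsSTPP A B C) (hB : ∀ i, (B i).Nonempty) :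
    ∑ k, (C k).card * (A k).card ≤ Fintype.card F ^ m := by
  rw [← card_pairData]
  have := Finset.card_le_card_of_injOn _ (fun x _ => Finset.mem_coe.2 (Finset.mem_univ _))
    (hS.injOn_sub hB)
  simpa [Fintype.card_pi] using this

/-- Hyperplane packing: if the blocks `k ∈ K` have `C_k − A_k ⊆ ξ^⊥` (`ξ ≠ 0`), then
`q · Σ_{k∈K} |C_k||A_k| ≤ q^m`. [folklore] -/
theorem IsSTPP.card_mul_sum_card_le (hS : IsSTPP A B C) (hB : ∀ i, (B i).Nonempty)
    {ξ : Fin m → F} (hξ : ξ ≠ 0) (K : Finset (Fin N))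
    (hK : ∀ k ∈ K, ∀ u' ∈ C k, ∀ s ∈ A k, ξ ⬝ᵥ (u' - s) = 0) :
    Fintype.card F * ∑ k ∈ K, (C k).card * (A k).card ≤ Fintype.card F ^ m := by
  rw [← LineSTPP.card_mul_card_hyperplane hξ]
  apply Nat.mul_le_mul_left
  have hsub : (K.sigma fun k => C k ×ˢ A k) ⊆ pairData C A := by
    intro x hx
    simp only [Finset.mem_sigma, Finset.mem_product, pairData, Finset.mem_univ, true_and] at hx ⊢
    exact hx.2
  have hmaps : Set.MapsTo (fun x : Σ _ : Fin N, (Fin m → F) × (Fin m → F) => x.2.1 - x.2.2)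
      ((K.sigma fun k => C k ×ˢ A k : Finset _) : Set _)
      ((univ.filter fun v : Fin m → F => ξ ⬝ᵥ v = 0 : Finset _) : Set _) := by
    rintro ⟨k, u', s⟩ hx
    simp only [Finset.coe_sigma, Finset.coe_product, Set.mem_sigma_iff, Finset.mem_coe,
      Set.mem_prod] at hx
    simp only [Finset.coe_filter, Finset.mem_univ, true_and, Set.mem_setOf_eq]
    exact hK k hx.1 u' hx.2.1 s hx.2.2
  have := Finset.card_le_card_of_injOn _ hmaps ((hS.injOn_sub hB).mono (by exact_mod_cast hsub))
  simpa [Finset.card_sigma, Finset.card_product] using this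

/-- The triple identity, inequality form: `Σ_ξ F_X F_Y F_Z = q^m · T` with
`T = #{(s'−t)+(t'−u)+(u'−s) = 0} ≤ Σ_i |A_i||B_i||C_i|` (STPP: only diagonal solutions); stated as
`‖Σ_ξ F_X F_Y F_Z − … ‖`-free equality with an explicit natural number `T`. [folklore] -/
theorem IsSTPP.sum_blockSum_mul_mul (ψ : AddChar F ℂ) (hψ : ψ.IsPrimitive) (hS : IsSTPP A B C) :
    ∃ T : ℕ, T ≤ ∑ i, (A i).card * (B i).card * (C i).card ∧
      ∑ ξ : Fin m → F, blockSum ψ A B ξ * blockSum ψ B C ξ * blockSum ψ C A ξ =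
        (Fintype.card F : ℂ) ^ m * T := by
  classical
  -- the solution set
  let S := ((pairData A B ×ˢ pairData B C) ×ˢ pairData C A).filter
    fun w => (w.1.1.2.1 - w.1.1.2.2) + (w.1.2.2.1 - w.1.2.2.2) + (w.2.2.1 - w.2.2.2) = 0
  refine ⟨S.card, ?_, ?_⟩
  · -- S ⊆ image of the diagonal embedding of Σ_i A_i × B_i × C_i
    let D : Finset (Σ _ : Fin N, (Fin m → F) × (Fin m → F) × (Fin m → F)) :=
      univ.sigma fun i => A i ×ˢ (B i ×ˢ C i)
    let e : (Σ _ : Fin N, (Fin m → F) × (Fin m → F) × (Fin m → F)) →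
        ((Σ _ : Fin N, (Fin m → F) × (Fin m → F)) × (Σ _ : Fin N, (Fin m → F) × (Fin m → F))) ×
          (Σ _ : Fin N, (Fin m → F) × (Fin m → F)) :=
      fun x => ((⟨x.1, (x.2.1, x.2.2.1)⟩, ⟨x.1, (x.2.2.1, x.2.2.2)⟩), ⟨x.1, (x.2.2.2, x.2.1)⟩)
    calc S.card ≤ (D.image e).card := by
          refine Finset.card_le_card fun w hw => ?_
          obtain ⟨⟨⟨i, s', t⟩, ⟨j, t', u⟩⟩, ⟨k, u', s⟩⟩ := w
          simp only [S, Finset.mem_filter, Finset.mem_product, pairData, Finset.mem_sigma,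
            Finset.mem_univ, true_and] at hw
          obtain ⟨⟨⟨hs', ht⟩, ⟨ht', hu⟩⟩, ⟨hu', hs⟩⟩ := hw.1
          obtain ⟨hij, hjk, hss, htt, huu⟩ := hS i j k s hs s' hs' t ht t' ht' u hu u' hu'
            (by rw [← hw.2]; abel)
          subst hij; subst hjk; subst hss; subst htt; subst huu
          exact Finset.mem_image.2 ⟨⟨i, (s, t, u)⟩, by simp [D, hs, ht, hu], rfl⟩
      _ ≤ D.card := Finset.card_image_le
      _ = ∑ i, (A i).card * (B i).card * (C i).card := by
          simp [D, Finset.card_sigma, Finset.card_product, mul_assoc]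
  · -- Fourier expansion
    calc ∑ ξ : Fin m → F, blockSum ψ A B ξ * blockSum ψ B C ξ * blockSum ψ C A ξ
        = ∑ ξ : Fin m → F, ∑ w ∈ (pairData A B ×ˢ pairData B C) ×ˢ pairData C A,
            ψ (ξ ⬝ᵥ ((w.1.1.2.1 - w.1.1.2.2) + (w.1.2.2.1 - w.1.2.2.2) + (w.2.2.1 - w.2.2.2))) := by
          refine Finset.sum_congr rfl fun ξ _ => ?_
          simp only [blockSum]
          rw [sum_mul_sum_mul_sum_eq_sum_product]
          refine Finset.sum_congr rfl fun w _ => ?_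
          rw [dotProduct_add, dotProduct_add, AddChar.map_add_eq_mul, AddChar.map_add_eq_mul]
      _ = ∑ w ∈ (pairData A B ×ˢ pairData B C) ×ˢ pairData C A, ∑ ξ : Fin m → F,
            ψ (ξ ⬝ᵥ ((w.1.1.2.1 - w.1.1.2.2) + (w.1.2.2.1 - w.1.2.2.2) + (w.2.2.1 - w.2.2.2))) :=
          Finset.sum_comm
      _ = ∑ w ∈ (pairData A B ×ˢ pairData B C) ×ˢ pairData C A,
            (if (w.1.1.2.1 - w.1.1.2.2) + (w.1.2.2.1 - w.1.2.2.2) + (w.2.2.1 - w.2.2.2) = 0 then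
              (Fintype.card F : ℂ) ^ m else 0) := by
          refine Finset.sum_congr rfl fun w _ => LineSTPP.sum_dotProduct_eq ψ hψ _
      _ = (Fintype.card F : ℂ) ^ m * S.card := by
          rw [Finset.sum_ite, Finset.sum_const_zero, add_zero, Finset.sum_const, nsmul_eq_mul,
            mul_comm]

/-- The square identity, inequality form: `Σ_ξ ‖F_X(ξ)‖² ≤ q^m · Σ_i |A_i||B_i|` (STPP pattern
`(i,i',i')`: `s' − t` determines the block and the pair; needs every `C_i` non-empty). [folklore] -/
theorem IsSTPP.sum_normSq_blockSum_le (ψ : AddChar F ℂ) (hψ : ψ.IsPrimitive) (hS : IsSTPP A B C)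
    (hC : ∀ i, (C i).Nonempty) :
    ∑ ξ : Fin m → F, Complex.normSq (blockSum ψ A B ξ) ≤
      (Fintype.card F : ℝ) ^ m * ∑ i, (A i).card * (B i).card := by
  classical
  have hp : 0 < ringChar F := by
    haveI : Fact (ringChar F).Prime := ⟨CharP.char_is_prime F _⟩
    exact (Fact.out : (ringChar F).Prime).pos
  -- normSq as a double character sum
  have hexp : ∀ ξ : Fin m → F, (Complex.normSq (blockSum ψ A B ξ) : ℂ) =
      ∑ w ∈ pairData A B ×ˢ pairData A B,
        ψ (ξ ⬝ᵥ ((w.2.2.1 - w.2.2.2) - (w.1.2.1 - w.1.2.2))) := by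
    intro ξ
    rw [Complex.normSq_eq_conj_mul_self, blockSum, map_sum, sum_mul_sum_eq_sum_product]
    refine Finset.sum_congr rfl fun w _ => ?_
    rw [AddChar.starComp_apply hp, AddChar.inv_apply, ← AddChar.map_add_eq_mul]
    congr 1
    rw [dotProduct_sub ξ (w.2.2.1 - w.2.2.2) (w.1.2.1 - w.1.2.2)]
    ring
  -- the solution set of s'−t = s''−t'' is the diagonal
  let S := (pairData A B ×ˢ pairData A B).filter
    fun w => (w.2.2.1 - w.2.2.2) - (w.1.2.1 - w.1.2.2) = 0
  have hScard : S.card ≤ ∑ i, (A i).card * (B i).card := by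
    rw [← card_pairData]
    calc S.card ≤ ((pairData A B).image fun x => (x, x)).card := by
          refine Finset.card_le_card fun w hw => ?_
          obtain ⟨⟨i, s', t⟩, ⟨i', s'', t''⟩⟩ := w
          simp only [S, Finset.mem_filter, Finset.mem_product, pairData, Finset.mem_sigma,
            Finset.mem_univ, true_and] at hw
          obtain ⟨⟨⟨hs', ht⟩, ⟨hs'', ht''⟩⟩, hw0⟩ := hw
          obtain ⟨u, hu⟩ := hC i'
          obtain ⟨hii, -, hss, htt, -⟩ := hS i i' i' s'' hs'' s' hs' t ht t'' ht'' u hu u hu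
            (by rw [sub_self, add_zero, ← neg_eq_zero.2 hw0]; abel)
          subst hii; subst hss; subst htt
          exact Finset.mem_image.2 ⟨⟨i, (s'', t)⟩, by simp [pairData, hs'', ht], rfl⟩
      _ ≤ (pairData A B).card := Finset.card_image_le
  -- Fourier expansion
  have hsum : ((∑ ξ : Fin m → F, Complex.normSq (blockSum ψ A B ξ) : ℝ) : ℂ) =
      (Fintype.card F : ℂ) ^ m * S.card := by
    push_cast
    calc ∑ ξ : Fin m → F, (Complex.normSq (blockSum ψ A B ξ) : ℂ)
        = ∑ ξ : Fin m → F, ∑ w ∈ pairData A B ×ˢ pairData A B,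
            ψ (ξ ⬝ᵥ ((w.2.2.1 - w.2.2.2) - (w.1.2.1 - w.1.2.2))) := Finset.sum_congr rfl fun ξ _ => hexp ξ
      _ = ∑ w ∈ pairData A B ×ˢ pairData A B, ∑ ξ : Fin m → F,
            ψ (ξ ⬝ᵥ ((w.2.2.1 - w.2.2.2) - (w.1.2.1 - w.1.2.2))) := Finset.sum_comm
      _ = ∑ w ∈ pairData A B ×ˢ pairData A B,
            (if (w.2.2.1 - w.2.2.2) - (w.1.2.1 - w.1.2.2) = 0 then (Fintype.card F : ℂ) ^ m else 0) :=
          Finset.sum_congr rfl fun w _ => LineSTPP.sum_dotProduct_eq ψ hψ _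
      _ = (Fintype.card F : ℂ) ^ m * S.card := by
          rw [Finset.sum_ite, Finset.sum_const_zero, add_zero, Finset.sum_const, nsmul_eq_mul,
            mul_comm]
  have hreal : ∑ ξ : Fin m → F, Complex.normSq (blockSum ψ A B ξ) =
      (Fintype.card F : ℝ) ^ m * S.card := by exact_mod_cast hsum
  rw [hreal]
  exact mul_le_mul_of_nonneg_left (by exact_mod_cast hScard) (by positivity)

omit [Fintype F] [DecidableEq F] in
/-- The analytic core of the cone inequality: given the triple identity `Σ f_X f_Y f_Z = W·T`, the
square bounds `Σ ‖f_X‖² ≤ W·P_AB`, `Σ ‖f_Y‖² ≤ W·P_BC`, the value `f_X f_Y f_Z (z) = P_AB P_BC P_CA`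
at a distinguished point `z` and a sup bound `‖f_Z‖ ≤ M` off `z`, we get
`P_AB P_BC P_CA − W T ≤ M · W · √(P_AB P_BC)` (split off `z`, Cauchy–Schwarz). [folklore] -/
theorem cone_core {ι : Type*} [Fintype ι] [DecidableEq ι] (z : ι) (fX fY fZ : ι → ℂ)
    {PAB PBC PCA W T M : ℝ} (h0 : fX z * fY z * fZ z = ((PAB * PBC * PCA : ℝ) : ℂ))
    (hid : ∑ ξ, fX ξ * fY ξ * fZ ξ = ((W * T : ℝ) : ℂ))
    (h2X : ∑ ξ, ‖fX ξ‖ ^ 2 ≤ W * PAB) (h2Y : ∑ ξ, ‖fY ξ‖ ^ 2 ≤ W * PBC)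
    (hM0 : 0 ≤ M) (hM : ∀ ξ, ξ ≠ z → ‖fZ ξ‖ ≤ M) (hW : 0 ≤ W) (hPAB : 0 ≤ PAB) (hPBC : 0 ≤ PBC) :
    PAB * PBC * PCA - W * T ≤ M * (W * Real.sqrt (PAB * PBC)) := by
  have hsplit : ∑ ξ, fX ξ * fY ξ * fZ ξ =
      fX z * fY z * fZ z + ∑ ξ ∈ univ.erase z, fX ξ * fY ξ * fZ ξ :=
    (Finset.add_sum_erase _ _ (Finset.mem_univ _)).symm
  have hrest : ∑ ξ ∈ univ.erase z, fX ξ * fY ξ * fZ ξ = ((W * T - PAB * PBC * PCA : ℝ) : ℂ) := by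
    rw [h0, hid] at hsplit
    push_cast at hsplit ⊢
    linear_combination -hsplit
  have hCS : ∑ ξ ∈ univ.erase z, ‖fX ξ‖ * ‖fY ξ‖ ≤ W * Real.sqrt (PAB * PBC) := by
    have hcs := Finset.sum_mul_sq_le_sq_mul_sq (univ.erase z) (fun ξ => ‖fX ξ‖) (fun ξ => ‖fY ξ‖)
    have hx : ∑ ξ ∈ univ.erase z, ‖fX ξ‖ ^ 2 ≤ W * PAB :=
      le_trans (Finset.sum_le_sum_of_subset_of_nonneg (Finset.erase_subset _ _)
        fun _ _ _ => sq_nonneg _) h2X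
    have hy : ∑ ξ ∈ univ.erase z, ‖fY ξ‖ ^ 2 ≤ W * PBC :=
      le_trans (Finset.sum_le_sum_of_subset_of_nonneg (Finset.erase_subset _ _)
        fun _ _ _ => sq_nonneg _) h2Y
    have hnn : 0 ≤ ∑ ξ ∈ univ.erase z, ‖fX ξ‖ * ‖fY ξ‖ :=
      Finset.sum_nonneg fun _ _ => mul_nonneg (norm_nonneg _) (norm_nonneg _)
    have hP0 : 0 ≤ PAB * PBC := mul_nonneg hPAB hPBC
    have hsq : (∑ ξ ∈ univ.erase z, ‖fX ξ‖ * ‖fY ξ‖) ^ 2 ≤ (W * Real.sqrt (PAB * PBC)) ^ 2 := by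
      calc (∑ ξ ∈ univ.erase z, ‖fX ξ‖ * ‖fY ξ‖) ^ 2
          ≤ (∑ ξ ∈ univ.erase z, ‖fX ξ‖ ^ 2) * ∑ ξ ∈ univ.erase z, ‖fY ξ‖ ^ 2 := hcs
        _ ≤ (W * PAB) * (W * PBC) :=
            mul_le_mul hx hy (Finset.sum_nonneg fun _ _ => sq_nonneg _) (by positivity)
        _ = (W * Real.sqrt (PAB * PBC)) ^ 2 := by
            rw [mul_pow, Real.sq_sqrt hP0]; ring
    exact (pow_le_pow_iff_left₀ hnn (by positivity) two_ne_zero).1 hsq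
  have hnorm : ‖∑ ξ ∈ univ.erase z, fX ξ * fY ξ * fZ ξ‖ ≤ M * (W * Real.sqrt (PAB * PBC)) := by
    calc ‖∑ ξ ∈ univ.erase z, fX ξ * fY ξ * fZ ξ‖
        ≤ ∑ ξ ∈ univ.erase z, ‖fX ξ * fY ξ * fZ ξ‖ := norm_sum_le _ _
      _ = ∑ ξ ∈ univ.erase z, ‖fX ξ‖ * ‖fY ξ‖ * ‖fZ ξ‖ := by simp
      _ ≤ ∑ ξ ∈ univ.erase z, ‖fX ξ‖ * ‖fY ξ‖ * M := by
          refine Finset.sum_le_sum fun ξ hξ => ?_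
          exact mul_le_mul_of_nonneg_left (hM ξ (Finset.ne_of_mem_erase hξ))
            (mul_nonneg (norm_nonneg _) (norm_nonneg _))
      _ = M * ∑ ξ ∈ univ.erase z, ‖fX ξ‖ * ‖fY ξ‖ := by rw [← Finset.sum_mul, mul_comm]
      _ ≤ M * (W * Real.sqrt (PAB * PBC)) := mul_le_mul_of_nonneg_left hCS hM0
  have hre : PAB * PBC * PCA - W * T = -(∑ ξ ∈ univ.erase z, fX ξ * fY ξ * fZ ξ).re := by
    rw [hrest, Complex.ofReal_re]; ring
  calc PAB * PBC * PCA - W * T = -(∑ ξ ∈ univ.erase z, fX ξ * fY ξ * fZ ξ).re := hre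
    _ ≤ ‖∑ ξ ∈ univ.erase z, fX ξ * fY ξ * fZ ξ‖ :=
        le_trans (neg_le_abs _) (Complex.abs_re_le_norm _)
    _ ≤ M * (W * Real.sqrt (PAB * PBC)) := hnorm

/-- **Cone inequality** for an STPP family in `F^m` (all `A_i`, `C_i` non-empty): if
`‖F_Z(ξ)‖ ≤ M` for every `ξ ≠ 0` (`F_Z = blockSum ψ C A`), then
`P_AB · P_BC · P_CA − q^m · Σ_i |A_i||B_i||C_i| ≤ M · q^m · √(P_AB · P_BC)` where
`P_AB = Σ_i |A_i||B_i|`, `P_BC = Σ_i |B_i||C_i|`, `P_CA = Σ_i |C_i||A_i|`.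
Proof: `cone_core` with the triple identity, the square identities (for `(A,B)` and, after rotating
the STPP, for `(B,C)`) and the values at `0`. [folklore] -/
theorem IsSTPP.cone_inequality (ψ : AddChar F ℂ) (hψ : ψ.IsPrimitive) (hS : IsSTPP A B C)
    (hA : ∀ i, (A i).Nonempty) (hC : ∀ i, (C i).Nonempty) {M : ℝ} (hM0 : 0 ≤ M)
    (hM : ∀ ξ : Fin m → F, ξ ≠ 0 → ‖blockSum ψ C A ξ‖ ≤ M) :
    ((∑ i, (A i).card * (B i).card : ℕ) : ℝ) * ((∑ i, (B i).card * (C i).card : ℕ) : ℝ) *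
        ((∑ i, (C i).card * (A i).card : ℕ) : ℝ) -
      (Fintype.card F : ℝ) ^ m * ((∑ i, (A i).card * (B i).card * (C i).card : ℕ) : ℝ) ≤
    M * ((Fintype.card F : ℝ) ^ m *
      Real.sqrt (((∑ i, (A i).card * (B i).card : ℕ) : ℝ) * ((∑ i, (B i).card * (C i).card : ℕ) : ℝ))) := by
  classical
  obtain ⟨T, hT, hid⟩ := hS.sum_blockSum_mul_mul ψ hψ
  have hS' : IsSTPP B C A := by
    intro i j k s hs s' hs' t ht t' ht' u hu u' hu' H
    obtain ⟨hki, hij, hU, hS_, hT'⟩ := hS k i j u hu u' hu' s hs s' hs' t ht t' ht'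
      (by rw [← H]; abel)
    refine ⟨hij, ?_, hS_, hT', hU⟩
    rw [← hij]; exact hki.symm
  have h2X := hS.sum_normSq_blockSum_le ψ hψ hC
  have h2Y := hS'.sum_normSq_blockSum_le ψ hψ hA
  simp only [Complex.normSq_eq_norm_sq] at h2X h2Y
  have hcore := cone_core (0 : Fin m → F) (blockSum ψ A B) (blockSum ψ B C) (blockSum ψ C A)
    (PAB := ((∑ i, (A i).card * (B i).card : ℕ) : ℝ))
    (PBC := ((∑ i, (B i).card * (C i).card : ℕ) : ℝ))
    (PCA := ((∑ i, (C i).card * (A i).card : ℕ) : ℝ))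
    (W := (Fintype.card F : ℝ) ^ m) (T := (T : ℝ)) (M := M)
    (by rw [blockSum_zero, blockSum_zero, blockSum_zero]; push_cast; ring)
    (by rw [hid]; push_cast; ring) h2X h2Y hM0 hM (by positivity) (by positivity) (by positivity)
  have hT' : (Fintype.card F : ℝ) ^ m * (T : ℝ) ≤
      (Fintype.card F : ℝ) ^ m * ((∑ i, (A i).card * (B i).card * (C i).card : ℕ) : ℝ) :=
    mul_le_mul_of_nonneg_left (by exact_mod_cast hT) (by positivity)
  linarith

end ConeIdentities

end Literature.Computability.AlgebraicComplexity
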